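import Literature.NumberTheory.Automorphic.AdicCompletionLocalField
import Literature.NumberTheory.Automorphic.AdicCompletionResidueCard
import Literature.NumberTheory.Automorphic.LParameter
import Literature.NumberTheory.GaloisRepresentations.DecompositionGroupOfCompletion
import Literature.NumberTheory.GaloisRepresentations.WeilDeligneRepLadicProofs
import Literature.NumberTheory.GaloisRepresentations.WeilGroupFrobeniusPowers
import Literature.NumberTheory.GaloisRepresentations.GaloisRepOfLadicLimit
import HarnessLib

/-!
# Local rigidity at an unramified generic place (stub `stub_localRigidity` of crux
# `GaloisRepOfRegularAlgebraic`, stmt-Langlands-10785, line `Sketch`)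

Let `K` be a number field, `v ∤ ℓ` a finite place, `r : Γ_K → GL_n(ℚ̄_ℓ)` a continuous
representation and `β` an `n`-element multiset of non-zero elements of `ℚ̄_ℓ`.  Suppose that every
`σ ∈ Γ_{K_v}` acting on the residue field as the `d`-th power of the arithmetic Frobenius
(`IsFrobPow σ d`, any `d : ℤ`) has `tr r(σ) = ∑_{b ∈ β} b ^ d` ("`r|_{Γ_{K_v}}` has unramified
semisimplification with Frobenius eigenvalues `β`", in trace form) and that no two elements of `β`
are in ratio `q_v` (the *generic gap*).  Then `r` is unramified at `v` and every arithmetic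
Frobenius at `v` has characteristic polynomial `∏_{b ∈ β} (X - b)`
(`stub_localRigidity`, with the linear-algebra lemma "generic gap kills monodromy" as an explicit
antecedent, as registered in the skeleton `Cruxes/GaloisRepOfRegularAlgebraic/Lines/Sketch.lean`).

Proof.  Restrict `r` to the Weil group `W_{K_v}` (continuous, `continuous_toAbsGalois_holds`).
Grothendieck's `ℓ`-adic monodromy theorem, PROVED in the tree (`exists_weilDeligneRep_of_ladic_holds`;
`‖q_v‖ = 1` in `ℚ̄_ℓ` because `v ∤ ℓ`), gives a Weil–Deligne representation `(ρ, N)`, an open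
subgroup `U` of inertia and a geometric Frobenius `Φ` with `r(u) = exp(t(u) N)` on `U` and
`ρ(Φ) = r(Φ)`.  The traces of `r(Φ^d) `, `d ≥ 1`, are the power sums of `β⁻¹`, so by Newton's
identities (`multiset_eq_of_psum_eq`) the roots of `charpoly r(Φ)` are `β⁻¹`; the Weil–Deligne
relation `ρ(Φ) N = q_v⁻¹ N ρ(Φ)` and the gap then force `N = 0` (the antecedent).  Hence `r` is
trivial on `U`, so every inertial `w` has `r(w)` of finite order (`exists_pow_mem_of_isOpen`) with
all power traces equal to `n`, i.e. unipotent (`charpoly = (X-1)^n`) of finite order, i.e. `1`.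
The passage from `Γ_{K_v}` to the global inertia and Frobenius elements at the primes above `v` is
the tree's dictionary (`isUnramifiedAt_iff_toLocal_holds`,
`decompositionSubgroup_adicCompletionPrime_eq_range`,
`isArithFrobAt_absGaloisRestrict_adicCompletionPrime_iff`, `exists_smul_eq_of_mem_primesAbove_holds`).

References: J. Tate, *Number theoretic background*, Corvallis 1979, §4.1–4.2; J.-P. Serre, J. Tate,
*Good reduction of abelian varieties*, Ann. of Math. 88 (1968), Appendix; P. Deligne, Antwerp II
(1973), §8.4.
-/

noncomputable section

set_option linter.dupNamespace false

open scoped MatrixGroups Matrix NumberField Polynomial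
open NumberField IsDedekindDomain Field Polynomial
open Literature.NumberTheory.GaloisRepresentations
open Literature.NumberTheory.GaloisRepresentations.IsNonarchimedeanLocalField (residueFieldCard)

namespace Summit.Langlands.Langlands.Theorems.GaloisRepOfRegularAlgebraic

/-! ### Linear algebra -/

section LinearAlgebra

variable {k : Type*} [Field k]

/-- **Newton's identities**: over an algebraically closed field of characteristic zero, a square
matrix whose first `n` power traces are the power sums of an `n`-element multiset `β` has
characteristic polynomial `∏_{b ∈ β} (X - b)` (`multiset_eq_of_psum_eq`,
`matrix_trace_pow_eq_sum_roots_pow`). [folklore] -/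
theorem charpoly_eq_prod_of_trace_pow_eq [IsAlgClosed k] [CharZero k] {n : ℕ}
    (A : Matrix (Fin n) (Fin n) k) (β : Multiset k) (hβ : Multiset.card β = n)
    (h : ∀ d : ℕ, 1 ≤ d → d ≤ n → (A ^ d).trace = (β.map fun b => b ^ d).sum) :
    A.charpoly = (β.map fun b => X - C b).prod := by
  classical
  have hmonic := Matrix.charpoly_monic A
  have hsplit : A.charpoly.Splits := IsAlgClosed.splits _
  have hcard : A.charpoly.roots.card = n := by
    rw [← hsplit.natDegree_eq_card_roots, Matrix.charpoly_natDegree_eq_dim, Fintype.card_fin]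
  have hroots : A.charpoly.roots = β := by
    refine LadicLimit.multiset_eq_of_psum_eq hcard hβ fun j hj1 hjn => ?_
    rw [← LadicLimit.matrix_trace_pow_eq_sum_roots_pow A j, h j hj1 hjn]
  rw [hsplit.eq_prod_roots_of_monic hmonic, hroots]

/-- A matrix all of whose positive powers have trace `n` is unipotent: its characteristic
polynomial is `(X - 1) ^ n` (Newton with `β = {1, …, 1}`). [folklore] -/
theorem charpoly_eq_X_sub_one_pow_of_trace_pow_eq [IsAlgClosed k] [CharZero k] {n : ℕ}
    (A : Matrix (Fin n) (Fin n) k) (h : ∀ d : ℕ, 1 ≤ d → (A ^ d).trace = n) :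
    A.charpoly = (X - 1) ^ n := by
  have := charpoly_eq_prod_of_trace_pow_eq A (Multiset.replicate n 1) (Multiset.card_replicate n 1)
    (fun d hd _ => by rw [h d hd, Multiset.map_replicate, one_pow, Multiset.sum_replicate,
      nsmul_eq_mul, mul_one])
  rwa [Multiset.map_replicate, Multiset.prod_replicate, map_one] at this

/-- In characteristic zero, a unipotent matrix of finite order is the identity: if
`charpoly A = (X - 1) ^ n` and `A ^ m = 1` with `m ≠ 0` then `A = 1`.  The minimal polynomial of
`A` divides `(X - 1) ^ n` (Cayley–Hamilton) and the separable polynomial `X ^ m - 1`, hence is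
squarefree, hence divides `X - 1`. [folklore] -/
theorem eq_one_of_charpoly_eq_of_pow_eq_one [CharZero k] {n : ℕ} (A : Matrix (Fin n) (Fin n) k)
    (hA : A.charpoly = (X - 1) ^ n) {m : ℕ} (hm : m ≠ 0) (hpow : A ^ m = 1) : A = 1 := by
  rcases Nat.eq_zero_or_pos n with rfl | hn
  · exact Subsingleton.elim _ _
  have h1 : aeval A ((X - C 1 : k[X]) ^ n) = 0 := by
    rw [map_one, ← hA]; exact Matrix.aeval_self_charpoly A
  have h2 : aeval A (X ^ m - C 1 : k[X]) = 0 := by simp [hpow]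
  have hd1 : minpoly k A ∣ (X - C 1) ^ n := minpoly.dvd k A h1
  have hd2 : minpoly k A ∣ X ^ m - C 1 := minpoly.dvd k A h2
  have hsep : (X ^ m - C (1 : k)).Separable :=
    separable_X_pow_sub_C 1 (Nat.cast_ne_zero.mpr hm) one_ne_zero
  have hsq : Squarefree (minpoly k A) := (hsep.of_dvd hd2).squarefree
  have hd3 : minpoly k A ∣ X - C 1 :=
    (hsq.dvd_pow_iff_dvd hn.ne').mp hd1
  obtain ⟨c, hc⟩ := hd3
  have h3 : aeval A (X - C 1 : k[X]) = 0 := by rw [hc, map_mul, minpoly.aeval, zero_mul]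
  simpa [sub_eq_zero] using h3

end LinearAlgebra

/-! ### `‖q_v‖ = 1` in `ℚ̄_ℓ` for `v ∤ ℓ` -/

section Norm

/-- In an ultrametric normed field in which the prime `p` has norm `< 1`, every natural number
prime to `p` has norm `1` (Bezout).  [folklore] -/
-- adapted from `Literature.NumberTheory.PAdicHodge.norm_natCast_eq_one_of_not_dvd` (AxSenTate.lean),
-- copied to keep this file's imports inside `GaloisRepresentations`/`Automorphic`.
theorem norm_natCast_eq_one_of_not_dvd {L : Type*} [NormedField L] [IsUltrametricDist L] {p : ℕ}
    (hp : p.Prime) (hpL : ‖(p : L)‖ < 1) {u : ℕ} (hu : ¬p ∣ u) : ‖(u : L)‖ = 1 := by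
  have hcop : Nat.Coprime p u := (Nat.Prime.coprime_iff_not_dvd hp).mpr hu
  refine le_antisymm (IsUltrametricDist.norm_natCast_le_one L u) ?_
  by_contra hlt
  rw [not_le] at hlt
  have hbez := Nat.gcd_eq_gcd_ab p u
  rw [Nat.Coprime.gcd_eq_one hcop, Nat.cast_one] at hbez
  have h1 : (1 : L) = (p : L) * (Nat.gcdA p u : ℤ) + (u : L) * (Nat.gcdB p u : ℤ) := by
    have := congrArg (fun z : ℤ => (z : L)) hbez
    push_cast at this
    exact this
  have hlt1 : ‖(1 : L)‖ < 1 := by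
    rw [h1]
    refine (IsUltrametricDist.norm_add_le_max _ _).trans_lt (max_lt ?_ ?_)
    · rw [norm_mul]
      exact mul_lt_one_of_nonneg_of_lt_one_left (norm_nonneg _) hpL
        (IsUltrametricDist.norm_intCast_le_one L _)
    · rw [norm_mul]
      exact mul_lt_one_of_nonneg_of_lt_one_left (norm_nonneg _) hlt
        (IsUltrametricDist.norm_intCast_le_one L _)
  rw [norm_one] at hlt1
  exact lt_irrefl _ hlt1

/-- **`‖q_v‖_ℓ = 1` for a finite place `v ∤ ℓ`**: the residue cardinality `q_v = p^f` is a power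
of the residue characteristic `p`, and `p ≠ ℓ` because `ℓ ∉ v`. [folklore] -/
theorem norm_residueCard_eq_one {K : Type} [Field K] [NumberField K] {ℓ : ℕ} [Fact ℓ.Prime]
    (v : HeightOneSpectrum (𝓞 K)) (hv : ((ℓ : ℕ) : 𝓞 K) ∉ v.asIdeal) :
    ‖(v.residueCard : PadicAlgCl ℓ)‖ = 1 := by
  classical
  haveI := v.isMaximal
  letI : Field (𝓞 K ⧸ v.asIdeal) := Ideal.Quotient.field v.asIdeal
  haveI : Finite (𝓞 K ⧸ v.asIdeal) := Ideal.finiteQuotientOfFreeOfNeBot v.asIdeal v.ne_bot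
  letI : Fintype (𝓞 K ⧸ v.asIdeal) := Fintype.ofFinite _
  set p := ringChar (𝓞 K ⧸ v.asIdeal) with hpdef
  haveI : CharP (𝓞 K ⧸ v.asIdeal) p := ringChar.charP _
  obtain ⟨f, hp, hcard⟩ := FiniteField.card (𝓞 K ⧸ v.asIdeal) p
  have hq : v.residueCard = p ^ (f : ℕ) := by
    rw [HeightOneSpectrum.residueCard_eq_card_quotient, Nat.card_eq_fintype_card, hcard]
  have hpv : ((p : ℕ) : 𝓞 K) ∈ v.asIdeal := by
    rw [← Ideal.Quotient.eq_zero_iff_mem, map_natCast]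
    exact ringChar.Nat.cast_ringChar
  have hℓ : _root_.Prime ℓ := (Fact.out : ℓ.Prime).prime
  have hℓp : ¬ ℓ ∣ p ^ (f : ℕ) := fun h =>
    hv (((Nat.prime_dvd_prime_iff_eq Fact.out hp).mp (hℓ.dvd_of_dvd_pow h)) ▸ hpv)
  have hℓnorm : ‖((ℓ : ℕ) : PadicAlgCl ℓ)‖ < 1 := by
    rw [← map_natCast (algebraMap ℚ_[ℓ] (PadicAlgCl ℓ)) ℓ]
    change ‖((ℓ : ℚ_[ℓ]) : PadicAlgCl ℓ)‖ < 1
    rw [PadicAlgCl.norm_extends]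
    exact Padic.norm_p_lt_one
  rw [hq]
  exact norm_natCast_eq_one_of_not_dvd Fact.out hℓnorm hℓp

end Norm

/-! ### The local lemma on the Weil group -/

section Local

open WeilGroup

variable {F : Type} [Field F] [ValuativeRel F] [TopologicalSpace F] [IsNonarchimedeanLocalField F]
variable {E : Type} [NontriviallyNormedField E] [CharZero E] [IsAlgClosed E] {n : ℕ}

/-- **Local rigidity on the Weil group.**  Let `ρ : W_F → GL_n(E)` be continuous (`E` a complete-ish
non-archimedean field with `‖q‖ = 1`, algebraically closed of characteristic `0`, e.g. `ℚ̄_ℓ`,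
`ℓ ∤ q`), and `β` an `n`-element multiset of non-zero scalars with `tr ρ(w) = ∑_b b ^ deg w` for
every `w ∈ W_F` and the generic gap `a ≠ q b` on `β`.  Granted the linear-algebra lemma "generic gap
kills monodromy" (`hMG`), `ρ` is trivial on the inertia group.  Proof: Grothendieck's monodromy
theorem (`exists_weilDeligneRep_of_ladic_holds`) gives `(ρ_WD, N)`, `U`, `Φ` with
`ρ = exp(t · N)` on `U` and `ρ_WD(Φ) = ρ(Φ)`; Newton's identities give
`roots (charpoly ρ(Φ)) = β⁻¹`, the Weil–Deligne relation `ρ(Φ) N = q⁻¹ N ρ(Φ)` and the gap give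
`N = 0`, so `ρ(U) = 1`; an inertial `w` then has `ρ(w)` of finite order with all power traces `n`,
hence `ρ(w) = 1`. [cite: TateCorvallis1979, §4.2 (4.2.1)] -/
theorem weilGroup_inertia_eq_one
    (hMG : ∀ {k : Type} [Field k] [IsAlgClosed k] {n : ℕ} (Φ N : Matrix (Fin n) (Fin n) k) (q : k),
      Φ * N = q • (N * Φ) →
      (∀ a ∈ Φ.charpoly.roots, ∀ b ∈ Φ.charpoly.roots, a ≠ q * b) → N = 0)
    (hq : ‖(residueFieldCard F : E)‖ = 1) (ρ : FramedRep (WeilGroup F) E n)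
    (β : Multiset E) (hβ : Multiset.card β = n)
    (htr : ∀ w : WeilGroup F,
      ((ρ w : GL (Fin n) E) : Matrix (Fin n) (Fin n) E).trace = (β.map fun b => b ^ (deg w)).sum)
    (hgap : ∀ a ∈ β, ∀ b ∈ β, a ≠ (residueFieldCard F : E) * b) :
    ∀ w ∈ inertia F, ρ w = 1 := by
  classical
  obtain ⟨r, t, U, Φ, hUI, hUo, hΦ, hexp, hρ⟩ := exists_weilDeligneRep_of_ladic_holds hq ρ
  set q : E := ((residueFieldCard F : ℕ) : E) with hqdef
  set Nm : Matrix (Fin n) (Fin n) E := LinearMap.toMatrix' r.N with hNm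
  set M : Matrix (Fin n) (Fin n) E := ((ρ Φ : GL (Fin n) E) : Matrix (Fin n) (Fin n) E) with hMdef
  -- (1) `ρ_WD(Φ) = ρ(Φ)` as matrices
  have hM : LinearMap.toMatrix' (r.ρ Φ) = M := by
    have := hρ 1 1
    simpa using this
  -- (2) the Weil–Deligne relation at `Φ`: `M N = q⁻¹ N M`
  have hrel : M * Nm = (q ^ (-1 : ℤ)) • (Nm * M) := by
    have := congrArg LinearMap.toMatrix' (r.conj_N Φ)
    rw [LinearMap.toMatrix'_comp, LinearEquiv.map_smul, LinearMap.toMatrix'_comp, hM, hΦ] at this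
    exact this
  -- (3) the roots of `charpoly M` are `β⁻¹`
  have hdegpow : ∀ d : ℕ, deg (Φ ^ d) = -(d : ℤ) := by
    intro d; rw [deg_pow, hΦ]; ring
  have hMpow : ∀ d : ℕ, 1 ≤ d → d ≤ n →
      (M ^ d).trace = ((β.map (·⁻¹)).map fun b => b ^ d).sum := by
    intro d _ _
    have := htr (Φ ^ d)
    rw [map_pow, Units.val_pow_eq_pow_val, hdegpow] at this
    rw [this, Multiset.map_map]
    refine congrArg _ (Multiset.map_congr rfl fun b _ => ?_)
    simp only [Function.comp_apply, zpow_neg, zpow_natCast, inv_pow]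
  have hchar : M.charpoly = ((β.map (·⁻¹)).map fun b => X - C b).prod :=
    charpoly_eq_prod_of_trace_pow_eq M _ (by rw [Multiset.card_map, hβ]) hMpow
  have hrootsM : M.charpoly.roots = β.map (·⁻¹) := by
    rw [hchar, Polynomial.roots_multiset_prod_X_sub_C]
  -- (4) `N = 0` by the gap
  have hN : Nm = 0 := by
    refine hMG M Nm (q ^ (-1 : ℤ)) hrel ?_
    intro a ha b hb
    rw [hrootsM, Multiset.mem_map] at ha hb
    obtain ⟨x, hx, rfl⟩ := ha
    obtain ⟨y, hy, rfl⟩ := hb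
    intro h
    apply hgap x hx y hy
    rw [zpow_neg, zpow_one, ← mul_inv] at h
    exact inv_injective h
  -- (5) `ρ = 1` on `U`
  have hU1 : ∀ u ∈ U, ρ u = 1 := by
    intro u hu
    have := hexp ⟨u, hUI hu⟩ hu
    rw [hN, smul_zero, IsNilpotent.exp_zero] at this
    exact Units.ext this
  -- (6) every inertial `w`: `ρ w` has finite order and is unipotent, hence `1`
  intro w hw
  obtain ⟨m, hm, hwm⟩ := exists_pow_mem_of_isOpen U hUo hw
  have hpow : ((ρ w : GL (Fin n) E) : Matrix (Fin n) (Fin n) E) ^ m = 1 := by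
    rw [← Units.val_pow_eq_pow_val, ← map_pow, hU1 _ hwm, Units.val_one]
  have htrk : ∀ d : ℕ, 1 ≤ d → (((ρ w : GL (Fin n) E) : Matrix (Fin n) (Fin n) E) ^ d).trace = n := by
    intro d _
    have hwd : deg (w ^ d) = 0 :=
      (deg_eq_zero_iff_mem_inertia IsFrobPow.mul_holds IsFrobPow.unique_holds).mpr (pow_mem hw d)
    have := htr (w ^ d)
    rw [map_pow, Units.val_pow_eq_pow_val, hwd] at this
    rw [this]
    simp [hβ]
  have hch := charpoly_eq_X_sub_one_pow_of_trace_pow_eq _ htrk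
  exact Units.ext (eq_one_of_charpoly_eq_of_pow_eq_one _ hch hm.ne' hpow)

end Local

/-! ### The stub: local rigidity for a global representation at `v ∤ ℓ` -/

section Global

open WeilGroup

/-- **Local rigidity** (registered stub `stub_localRigidity` of the skeleton
`Cruxes/GaloisRepOfRegularAlgebraic/Lines/Sketch.lean`, crux stmt-Langlands-10785).  Granted the
linear-algebra lemma "generic gap kills monodromy" (first antecedent; landed separately as
`stub_monodromyGap`): for a number field `K`, a finite place `v ∤ ℓ`, a continuous
`r : Γ_K → GL_n(ℚ̄_ℓ)` and an `n`-element multiset `β` of non-zero elements of `ℚ̄_ℓ`, if every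
`σ ∈ Γ_{K_v}` of Frobenius degree `d` has `tr r(σ) = ∑_{b ∈ β} b ^ d` and no two elements of `β`
are in ratio `q_v`, then `r` is unramified at `v` and every arithmetic Frobenius at `v` has
characteristic polynomial `∏_{b ∈ β} (X - b)`.  Proof: `weilGroup_inertia_eq_one` on
`r|_{W_{K_v}}` (`‖q_v‖_ℓ = 1`, `norm_residueCard_eq_one`), then the tree's local–global dictionary:
`I_{K_v} = I(W_{K_v})` (`inertia_map_toAbsGalois`), `isUnramifiedAt_iff_toLocal_holds`; for the
Frobenius clause, a Frobenius at the prime `𝔓₀` cut out by `K̄ → \bar K_v` is the restriction of a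
local arithmetic Frobenius (`decompositionSubgroup_adicCompletionPrime_eq_range`,
`isArithFrobAt_absGaloisRestrict_adicCompletionPrime_iff`), whose powers have the prescribed
traces, so Newton gives the characteristic polynomial; the other primes above `v` are conjugate
(`exists_smul_eq_of_mem_primesAbove_holds`, `IsArithFrobAt.conj`) and the characteristic polynomial
is a class function. [cite: TateCorvallis1979, §4.2 (4.2.1)] -/
theorem stub_localRigidity :
    (∀ {k : Type} [Field k] [IsAlgClosed k] {n : ℕ} (Φ N : Matrix (Fin n) (Fin n) k) (q : k),
      Φ * N = q • (N * Φ) →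
      (∀ a ∈ Φ.charpoly.roots, ∀ b ∈ Φ.charpoly.roots, a ≠ q * b) → N = 0) →
    ∀ {K : Type} [Field K] [NumberField K] {ℓ : ℕ} [Fact ℓ.Prime] {n : ℕ}
      (v : HeightOneSpectrum (𝓞 K)), ((ℓ : ℕ) : 𝓞 K) ∉ v.asIdeal →
      ∀ (r : FramedGaloisRep K (PadicAlgCl ℓ) n) (β : Multiset (PadicAlgCl ℓ)),
        Multiset.card β = n → (0 : PadicAlgCl ℓ) ∉ β →
        (∀ (σ : absoluteGaloisGroup (v.adicCompletion K)) (d : ℤ), IsFrobPow σ d →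
          (((r.toLocal v) σ : GL (Fin n) (PadicAlgCl ℓ)) : Matrix (Fin n) (Fin n) (PadicAlgCl ℓ)).trace
            = (β.map fun b => b ^ d).sum) →
        (∀ a ∈ β, ∀ b ∈ β, a ≠ (v.residueCard : PadicAlgCl ℓ) * b) →
        r.IsUnramifiedAt v ∧ r.HasFrobCharpolyAt v ((β.map fun b => X - C b).prod) := by
  intro hMG K _ _ ℓ _ n v hv r β hβ _h0 htr hgap
  classical
  -- the residue cardinality of `K_v`, and its norm in `ℚ̄_ℓ`
  have hqF : residueFieldCard (v.adicCompletion K) = v.residueCard :=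
    Literature.NumberTheory.Automorphic.residueFieldCard_adicCompletion_eq K v
  have hq1 : ‖((residueFieldCard (v.adicCompletion K) : ℕ) : PadicAlgCl ℓ)‖ = 1 := by
    rw [hqF]; exact norm_residueCard_eq_one v hv
  -- the restriction of `r` to the Weil group of `K_v`
  let ι : WeilGroup (v.adicCompletion K) →ₜ* absoluteGaloisGroup (v.adicCompletion K) :=
    ⟨toAbsGalois (v.adicCompletion K), continuous_toAbsGalois_holds (v.adicCompletion K)⟩
  let ρW : FramedRep (WeilGroup (v.adicCompletion K)) (PadicAlgCl ℓ) n := (r.toLocal v).comp ι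
  have hρW : ∀ w, ρW w = r.toLocal v (toAbsGalois (v.adicCompletion K) w) := fun _ => rfl
  have htrW : ∀ w : WeilGroup (v.adicCompletion K),
      ((ρW w : GL (Fin n) (PadicAlgCl ℓ)) : Matrix (Fin n) (Fin n) (PadicAlgCl ℓ)).trace =
        (β.map fun b => b ^ (deg w)).sum :=
    fun w => htr _ _ (isFrobPow_deg IsFrobPow.mul_holds w)
  have hgap' : ∀ a ∈ β, ∀ b ∈ β,
      a ≠ ((residueFieldCard (v.adicCompletion K) : ℕ) : PadicAlgCl ℓ) * b := by
    rw [hqF]; exact hgap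
  have hI : ∀ w ∈ inertia (v.adicCompletion K), ρW w = 1 :=
    weilGroup_inertia_eq_one hMG hq1 ρW β hβ htrW hgap'
  -- `r|_{Γ_{K_v}}` kills the local inertia group
  have hloc : ∀ σ ∈ absInertia (v.adicCompletion K), r.toLocal v σ = 1 := by
    intro σ hσ
    rw [← inertia_map_toAbsGalois, Subgroup.mem_map] at hσ
    obtain ⟨w, hw, rfl⟩ := hσ
    exact hI w hw
  -- hence `r` is unramified at `v`
  have hunr : r.IsUnramifiedAt v := by
    refine (FramedGaloisRep.isUnramifiedAt_toGaloisRep_iff v r).mp ?_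
    refine (GaloisRep.isUnramifiedAt_iff_toLocal_holds v r.toGaloisRep).mpr fun σ hσ => ?_
    change FramedRep.toRepresentation (r.toLocal v) σ = 1
    refine LinearMap.ext fun x => ?_
    simp [hloc σ hσ]
  refine ⟨hunr, ?_⟩
  -- the Frobenius clause at the distinguished prime `𝔓₀ = adicCompletionPrime K v`
  have hqN : residueFieldCard (v.adicCompletion K) = Nat.card (𝓞 K ⧸ v.asIdeal) :=
    hqF.trans (HeightOneSpectrum.residueCard_eq_card_quotient v)
  have hkey : ∀ τ : absoluteGaloisGroup K, IsArithFrobAt (𝓞 K) τ (adicCompletionPrime K v) →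
      FramedRep.charpoly r τ = (β.map fun b => X - C b).prod := by
    intro τ hτ
    have hmem : τ ∈ (adicCompletionPrime K v).decompositionSubgroup (absoluteGaloisGroup K) :=
      hτ.mem_stabilizer
    rw [decompositionSubgroup_adicCompletionPrime_eq_range] at hmem
    obtain ⟨τ', rfl⟩ := hmem
    have hF : IsAbsArithFrob τ' :=
      (isArithFrobAt_absGaloisRestrict_adicCompletionPrime_iff K v hqN τ').mp hτ
    have h1 : IsFrobPow τ' 1 := IsAbsArithFrob.isFrobPow_holds hF
    refine charpoly_eq_prod_of_trace_pow_eq _ β hβ fun d _ _ => ?_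
    have hd : IsFrobPow (τ' ^ d) (d : ℤ) := by simpa using h1.pow d
    have := htr (τ' ^ d) d hd
    rw [map_pow, Units.val_pow_eq_pow_val] at this
    simpa [zpow_natCast] using this
  -- transport to every prime above `v`
  intro 𝔓 h𝔓 σ hσ
  obtain ⟨g, rfl⟩ := HeightOneSpectrum.exists_smul_eq_of_mem_primesAbove_holds
    (adicCompletionPrime_mem_primesAbove K v) h𝔓
  have hσ' : IsArithFrobAt (𝓞 K) (g⁻¹ * σ * g) (adicCompletionPrime K v) := by
    simpa using hσ.conj g⁻¹
  have hconj : FramedRep.charpoly r (g⁻¹ * σ * g) = FramedRep.charpoly r σ := by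
    simp only [FramedRep.charpoly, map_mul, map_inv, Units.val_mul, Matrix.coe_units_inv]
    exact Matrix.charpoly_units_conj' _ _
  rw [← hconj]
  exact hkey _ hσ'

end Global

end Summit.Langlands.Langlands.Theorems.GaloisRepOfRegularAlgebraic

end
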